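import Summits.BirchSwinnertonDyer.BirchSwinnertonDyer.Theorems.ResidualThetaTransportAtTwoAwayDefs
import Summits.BirchSwinnertonDyer.BirchSwinnertonDyer.Theorems.ResidualThetaTransportAtTwoResidualSignedLambdaLowerCMAtTwoSupplyCount
import Summits.BirchSwinnertonDyer.BirchSwinnertonDyer.Theorems.ResidualThetaTransportAtTwoResidualSignedLambdaLowerCMAtTwoColemanSideInjective
import Summits.BirchSwinnertonDyer.BirchSwinnertonDyer.Theorems.ResidualThetaTransportAtTwoResidualSignedLambdaLowerCMAtTwoColemanSideCoordinates
import Summits.BirchSwinnertonDyer.BirchSwinnertonDyer.Theorems.ResidualThetaTransportAtTwoResidualSignedLambdaLowerCMAtTwoRhoLayerPairingConjGlue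
import Summits.BirchSwinnertonDyer.BirchSwinnertonDyer.Theorems.ResidualThetaTransportAtTwoResidualSignedLambdaLowerCMAtTwoCofreeTorsionCount
import Summits.BirchSwinnertonDyer.BirchSwinnertonDyer.Theorems.ResidualThetaTransportAtTwoResidualSignedLambdaLowerCMAtTwoColemanPlusHomTwist
import HarnessLib

/-!
# GLUE clause (7) AT THE PINS: FIN and COUNT of `P = Λⁿ × P_{S₀} ⧸ span (locd (Λ_𝒪 z))`, `locd = (π.cvec, πₐ.locdS)` — from (nz⁺), (i_D), S1⊕ and the
# pins' Coleman-side linearity/injectivity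

Route `ResidualThetaTransportAtTwo` (RTT), crux RSL_g `ResidualSignedLambdaLowerCMAtTwo` (stmt-BirchSwinnertonDyer-22608), line «onepair» (v3d), GLUE-SPEC-g18 §2 (7)
(LEAD rtt-p2 g19 ask 08:30:12Z (a)). Seat `prover-bsd-wall-tp2-p2x-w2` g20 (`--supports`, closes nothing). THEOREMS ONLY. BSD is not proved by any of this.

For a pin bundle `π : OnePairPins …`, an S₀-side bundle `πₐ : AwayPins … π`, a class `z ∈ 𝐇¹` and ANY additive `locd : 𝐇¹ →+ Λⁿ × P_{S₀}` with
`locd x = (π.cvec x, πₐ.locdS x)` (`Λ = ℤ₂⟦X⟧`):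
* §1 `OnePairPins.exists_col_twist` — the twist clause `col (z ∘ g⁻¹) = (1 + X) · col z` for the generator of `π.hcol` (PORT of stub-ideation
  `Cruxes/ResidualThetaCountLowerPureAtTwo/Sketch_sidea_k4_g20.lean` §1, credit sidea-k4 g20; `SignedColemanImage.plusCongr_precomp_inv`);
  `OnePairPins.exists_cvecHom` (`π.cvec` as an additive map), `cvec_map_X_smul` / `cvec_map_C_smul` / `cvec_map_smul` (LIN-X, LIN-C₀ and full
  `ℤ₂⟦X⟧`-semilinearity of `𝒸 = π.cvec` on `𝐇¹`, from `ThetaTransport.cTuple_mapCoeff_X_smul/_C_smul` and `ColemanSideInjective.apply_smul_eq_smul_of_X_of_C`).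
* §2 **`OnePairPins.finite_and_count_span_locd_pins`** — `Module.Finite ℚ₂ (ℚ₂ ⊗ (P ⧸ span_{ℤ₂} (locd '' Λ_𝒪 z)))` and
  `f·(d + σ + e) ≤ dim_{ℚ₂} (ℚ₂ ⊗ (P ⧸ span_{ℤ₂} (locd '' Λ_𝒪 z)))` from (nz⁺) `Module.Finite ℚ₂ (ℚ₂ ⊗ π.colocdQuot z)`, (i_D) `f·(d+e) ≤ λ(π.colocdQuot z)`,
  S1⊕ `Module.Finite` + `f·σ ≤ λ(P_{S₀})` — the hypotheses (LIN) `hN` (`ColemanSideInjective.image_eq_range_present`), (SAT) `hZ` (`cvec_map_C_smul` +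
  `πₐ.hlocdS_smul`), (INJ) `hinjZ` (`eq_zero_of_apply_smul_zeta_eq_zero_two_of_X_of_C` with `n = f` by `CofreeTorsionCount.n_eq_of_theta`) of
  `OnePair.finite_and_count_span_locd` (p703164) DISCHARGED from the pins.

References: [Washington1997] §13.2; [Kobayashi2003] Thm. 6.2 (6.13), Thm. 7.3; [Kato2004Asterisque] §12.2, Thm. 12.4–12.5, §13.8; [Sprung2012] Prop. 7.3.
-/

set_option autoImplicit false
-- the Theorems namespace of this sub repeats the summit name by design (D-0017 nested layout)
set_option linter.dupNamespace false

noncomputable section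

open scoped Classical TensorProduct

namespace Summit.BirchSwinnertonDyer.BirchSwinnertonDyer.Theorems.OnePair.OnePairPins

open CategoryTheory Field NumberField IsDedekindDomain
  Literature.NumberTheory.EllipticCurves Literature.NumberTheory.GaloisRepresentations
  Literature.NumberTheory.EllipticCurves.GreenbergSelmer Literature.NumberTheory.EllipticCurves.Kobayashi2003
  Literature.NumberTheory.EllipticCurves.Sprung2012
  Summit.BirchSwinnertonDyer.BirchSwinnertonDyer.Theorems.ThetaTransport
  Summit.BirchSwinnertonDyer.BirchSwinnertonDyer.Theorems.ColemanSideInjective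

variable {S : Set (PadicAlgCl 2)} {W : WeierstrassCurve ℚ} [W.IsElliptic] {κ : ZpExtension ℚ 2} {γ : absoluteGaloisGroup ℚ}
  {S₀ : Finset (HeightOneSpectrum (𝓞 ℚ))} {n : ℕ} {ρ : FramedGaloisRep ℚ ↥(padicCoeffIntegers S) 2}
  {Θ : ∀ v : HeightOneSpectrum (𝓞 ℚ), ((2 : ℕ) : 𝓞 ℚ) ∈ v.asIdeal → (Cofree ρ ↥(padicCoeffField S) ≃+ (Fin n → ↥(W.geomPrimaryTorsion 2)))}
  {hΘ : ∀ v hv (δ : absoluteGaloisGroup (v.adicCompletion ℚ)) m i,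
    Θ v hv (resGalOfEmb (closureEmb (K := ℚ) (v.adicCompletion ℚ)) δ • m) i = resGalOfEmb (closureEmb (K := ℚ) (v.adicCompletion ℚ)) δ • Θ v hv m i}
  {I : Kato2004.IwasawaH1DataCoeff (FramedGaloisRep.toGaloisRep ρ) 2 κ γ}
  {Sg : AddSubgroup (subgroupH1 κ.kerSubgroup (Cofree ρ ↥(padicCoeffField S)))} [Module ↥(padicCoeffIntegers S) ↥Sg]
  (π : OnePairPins S W κ γ S₀ n ρ Θ hΘ I Sg)

/-! ## §1 The twist clause, `cvec` as an additive map, and its `ℤ₂⟦X⟧`-semilinearity -/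

/-- **The twist clause from the pins** (PORT of `Sketch_sidea_k4_g20.lean` §1 `exists_col_twist`, credit stub-ideation sidea-k4 g20): for the generator `gH` of
`π.hcol`, `col (z ∘ gH⁻¹) = (1 + X) · col z` for every functional `z` on the tower points (the congruences make `(1+X)·col z` a plus value of `z ∘ gH⁻¹`
by `SignedColemanImage.plusCongr_precomp_inv`; uniqueness pins it). [cite: Kobayashi2003, Thm. 6.2 (6.13), §8 (8.20)–(8.23)] [cite: Sprung2012, Prop. 7.3] -/
theorem exists_col_twist :
    ∃ g : absoluteGaloisGroup (π.v.adicCompletion ℚ),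
      κ.IsTopGenerator (resGalOfEmb (closureEmb (K := ℚ) (π.v.adicCompletion ℚ)) g) ∧
      ∀ z z' : ↥(localTowerPointsOfEmb κ (closureEmb (K := ℚ) (π.v.adicCompletion ℚ)) W) →+ ℤ_[2],
        (∀ a : ↥(localTowerPointsOfEmb κ (closureEmb (K := ℚ) (π.v.adicCompletion ℚ)) W),
          z' a = z ⟨g⁻¹ • (a : localPoints W (π.v.adicCompletion ℚ)), smul_mem_localTowerPointsOfEmb κ _ W g⁻¹ a.2⟩) →
        π.col z' = (1 + PowerSeries.X) * π.col z := by
  -- adapted from Cruxes/ResidualThetaCountLowerPureAtTwo/Sketch_sidea_k4_g20.lean §1 (sidea-k4 g20)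
  obtain ⟨gH, dH, hdA, hg, hd, -, -, hcong, hpin⟩ := π.hcol
  refine ⟨gH, hg, fun z z' hz' => (hpin z' _ fun m => ?_).symm⟩
  have hfix : gH ^ 2 ^ (2 * m) • dH (2 * m) = dH (2 * m) := by
    simpa using pow_mul_smul_of_mem_localLayerPointsOfEmb κ (closureEmb (K := ℚ) (π.v.adicCompletion ℚ)) W hg (hd (2 * m)) 1
  have hω : (((cyclotomicOmega 2 (2 * m)).map (Int.castRingHom ℤ_[2]) : Polynomial ℤ_[2]) : PowerSeries ℤ_[2]) =
      (((Polynomial.X + 1) ^ 2 ^ (2 * m) - 1 : Polynomial ℤ_[2]) : PowerSeries ℤ_[2]) := by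
    rw [SignedColemanImage.map_cyclotomicOmega]
  rw [hω]
  exact SignedColemanImage.plusCongr_precomp_inv (localTowerPointsOfEmb κ (closureEmb (K := ℚ) (π.v.adicCompletion ℚ)) W)
    (fun σ a ha ↦ smul_mem_localTowerPointsOfEmb κ _ W σ ha) gH (pow_pos two_pos _) (dH (2 * m)) hfix (hdA (2 * m))
    z z' hz' _ (π.col z) (by have := hcong z m; rwa [hω] at this)

/-- **`π.cvec` is additive**: there is `𝒸 : 𝐇¹ →+ Λⁿ` with `𝒸 x = π.cvec x` (`locd₂`, composition with `single i` and `col` are additive). [cite: Kobayashi2003, Thm. 6.2 (p. 18)] -/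
theorem exists_cvecHom : ∃ 𝒸 : I.H →+ (Fin n → PowerSeries ℤ_[2]), ∀ x, 𝒸 x = π.cvec x :=
  ⟨{ toFun := π.cvec
     map_zero' := by
       funext i
       rw [cvec_apply, map_zero, AddMonoidHom.zero_comp, map_zero, Pi.zero_apply]
     map_add' := fun x y ↦ by
       funext i
       rw [Pi.add_apply, cvec_apply, cvec_apply, cvec_apply, map_add, AddMonoidHom.add_comp, map_add] }, fun _ ↦ rfl⟩

/-- **LIN-X for `𝒸 = π.cvec`**: `π.cvec ((map ι X) • x) = X • π.cvec x` on all of `𝐇¹` (`cTuple_mapCoeff_X_smul` fed with §1 and the pins `hpair`/`hlocd₂`).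
[cite: Kato2004Asterisque, §12.2 (p. 220)] [cite: Kobayashi2003, Thm. 6.2 (6.13)] -/
theorem cvec_map_X_smul (hγ : κ.IsTopGenerator γ) (x : I.H) :
    π.cvec (PowerSeries.map (padicIntToCoeffIntegers S) PowerSeries.X • x) = (PowerSeries.X : PowerSeries ℤ_[2]) • π.cvec x := by
  obtain ⟨𝒸, h𝒸⟩ := π.exists_cvecHom
  obtain ⟨g, hg, htw⟩ := π.exists_col_twist
  rw [← h𝒸, ← h𝒸]
  exact cTuple_mapCoeff_X_smul S ρ W π.ePk π.hμPk π.hadd₁Pk π.hadd₂Pk π.hgalPk (Θ π.v π.hv) π.v (hΘ π.v π.hv) I π.pair π.hpair π.hlocd₂ π.col 𝒸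
    (fun y i ↦ by rw [h𝒸, cvec_apply]) hγ hg htw x

/-- **LIN-C₀ for `𝒸 = π.cvec`**: `π.cvec ((map ι (C a)) • x) = C a • π.cvec x` (`cTuple_mapCoeff_C_smul`). [cite: Kato2004Asterisque, §12.2 (p. 220), §13.8 (p. 228)] -/
theorem cvec_map_C_smul (a : ℤ_[2]) (x : I.H) :
    π.cvec (PowerSeries.map (padicIntToCoeffIntegers S) (PowerSeries.C a) • x) = (PowerSeries.C a : PowerSeries ℤ_[2]) • π.cvec x := by
  obtain ⟨𝒸, h𝒸⟩ := π.exists_cvecHom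
  rw [← h𝒸, ← h𝒸]
  exact cTuple_mapCoeff_C_smul S ρ W π.ePk π.hμPk π.hadd₁Pk π.hadd₂Pk π.hgalPk (Θ π.v π.hv) π.v (hΘ π.v π.hv) I π.pair π.hpair π.hlocd₂ π.col 𝒸
    (fun y i ↦ by rw [h𝒸, cvec_apply]) a x

/-- **`π.cvec` is `ℤ₂⟦X⟧`-semilinear on `𝐇¹`** along `map ι : ℤ₂⟦X⟧ → 𝒪⟦X⟧`: `π.cvec ((map ι s) • x) = s • π.cvec x` for EVERY power series `s` (finite-to-full:
`X`-adic separatedness of `Λⁿ`, `apply_smul_eq_smul_of_X_of_C`). [cite: Kato2004Asterisque, §12.2 (p. 220)] [cite: Lang1990, Ch. 6 §2 (p. 111)] -/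
theorem cvec_map_smul (hγ : κ.IsTopGenerator γ) (s : PowerSeries ℤ_[2]) (x : I.H) :
    π.cvec (PowerSeries.map (padicIntToCoeffIntegers S) s • x) = s • π.cvec x := by
  obtain ⟨𝒸, h𝒸⟩ := π.exists_cvecHom
  have h := apply_smul_eq_smul_of_X_of_C eq_zero_of_forall_X_pow_smul (PowerSeries.map (padicIntToCoeffIntegers S)) 𝒸 (⊤ : Submodule (IwasawaAlgebraO S) I.H)
    (fun y _ ↦ by rw [h𝒸, h𝒸]; exact π.cvec_map_X_smul hγ y) (fun a y _ ↦ by rw [h𝒸, h𝒸]; exact π.cvec_map_C_smul a y) s x Submodule.mem_top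
  rwa [h𝒸, h𝒸] at h

/-! ## §2 Clause (7) at the pins -/

variable [∀ w : ↥S₀, Module ℤ_[2] (Dloc S κ ρ (w : HeightOneSpectrum (𝓞 ℚ)))] (πₐ : AwayPins S κ ρ S₀ W γ n Θ hΘ I Sg π)

-- the quotient `Λⁿ × P_{S₀} ⧸ span …` and (nz⁺)'s `colocdQuot` are large types; instance search through them needs more than the default budget
set_option maxHeartbeats 1600000 in
/-- **GLUE clause (7) AT THE PINS — FIN and COUNT of the one-pair datum.** For `π : OnePairPins`, `πₐ : AwayPins π`, `z ∈ 𝐇¹` and any additive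
`locd : 𝐇¹ →+ Λⁿ × P_{S₀}` with `locd x = (π.cvec x, πₐ.locdS x)`: given (nz⁺) `Module.Finite ℚ₂ (ℚ₂ ⊗ π.colocdQuot z)`, (i_D) `f·(d + e) ≤ λ(π.colocdQuot z)`
and S1⊕ (`Module.Finite ℚ₂ (ℚ₂ ⊗ P_{S₀})`, `f·σ ≤ λ(P_{S₀})`) with `f = π.f`: `ℚ₂ ⊗ (P ⧸ span_{ℤ₂} (locd '' Λ_𝒪 z))` is finite-dimensional and
`f·(d + σ + e) ≤ dim_{ℚ₂} ℚ₂ ⊗ (P ⧸ span_{ℤ₂} (locd '' Λ_𝒪 z))`. = `OnePair.finite_and_count_span_locd` (p703164) with (LIN) from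
`image_eq_range_present` + `cvec_map_smul`, (SAT) from `cvec_map_C_smul` + `πₐ.hlocdS_smul`, (INJ) from `eq_zero_of_apply_smul_zeta_eq_zero_two_of_X_of_C`
(coordinates `exists_iwasawaAlgebraO_coordinates π.B π.hB` transported along `n = f`, `CofreeTorsionCount.n_eq_of_theta`).
[cite: Washington1997, §13.2] [cite: Kobayashi2003, Thm. 7.3 ((7.21), p. 13)] [cite: Kato2004Asterisque, Thm. 12.4–12.5] -/
theorem finite_and_count_span_locd_pins (hγ : κ.IsTopGenerator γ) (z : I.H)
    (locd : I.H →+ (Fin n → PowerSeries ℤ_[2]) × PAway S κ ρ S₀) (hlocd : ∀ x, locd x = (π.cvec x, πₐ.locdS x))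
    [Module.Finite ℚ_[2] (ℚ_[2] ⊗[ℤ_[2]] π.colocdQuot z)] [Module.Finite ℚ_[2] (ℚ_[2] ⊗[ℤ_[2]] PAway S κ ρ S₀)]
    {d e σ : ℕ} (hQ : π.f * (d + e) ≤ lamTwo 2 (π.colocdQuot z)) (hS : π.f * σ ≤ lamTwo 2 (PAway S κ ρ S₀)) :
    Module.Finite ℚ_[2] (ℚ_[2] ⊗[ℤ_[2]] (((Fin n → PowerSeries ℤ_[2]) × PAway S κ ρ S₀) ⧸
        Submodule.span ℤ_[2] (locd '' (Submodule.span (IwasawaAlgebraO S) ({z} : Set I.H) : Set I.H)))) ∧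
      π.f * (d + σ + e) ≤ Module.finrank ℚ_[2] (ℚ_[2] ⊗[ℤ_[2]] (((Fin n → PowerSeries ℤ_[2]) × PAway S κ ρ S₀) ⧸
        Submodule.span ℤ_[2] (locd '' (Submodule.span (IwasawaAlgebraO S) ({z} : Set I.H) : Set I.H)))) := by
  -- `𝒸 = π.cvec` as an additive map, semilinear on `𝐇¹`
  obtain ⟨𝒸, h𝒸⟩ := π.exists_cvecHom
  have hsemi : ∀ (s : PowerSeries ℤ_[2]) (x : I.H), x ∈ Submodule.span (IwasawaAlgebraO S) ({z} : Set I.H) →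
      𝒸 (PowerSeries.map (padicIntToCoeffIntegers S) s • x) = (RingEquiv.refl (PowerSeries ℤ_[2])) s • 𝒸 x := fun s x _ ↦ by
    rw [RingEquiv.refl_apply, h𝒸, h𝒸]; exact π.cvec_map_smul hγ s x
  -- `ℤ₂⟦X⟧`-coordinates of `Λ_𝒪` (on `Fin f`)
  obtain ⟨bvec, crd, hsum⟩ := exists_iwasawaAlgebraO_coordinates S π.B π.hB
  obtain ⟨Φ, hΦ⟩ := exists_present (PowerSeries.map (padicIntToCoeffIntegers S)) 𝒸 z (RingEquiv.refl _) hsemi bvec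
  -- (LIN): the image set is the Λ-span
  have hN : (fun x => (locd x).1) '' (((Submodule.span (IwasawaAlgebraO S) ({z} : Set I.H)).toAddSubgroup : AddSubgroup I.H) : Set I.H) =
      (Submodule.span (PowerSeries ℤ_[2]) (π.cvec '' (Submodule.span (IwasawaAlgebraO S) ({z} : Set I.H) : Set I.H)) : Set _) := by
    have h1 : (fun x => (locd x).1) = 𝒸 := funext fun x ↦ by rw [hlocd, h𝒸]
    have h2 : (π.cvec : I.H → Fin n → PowerSeries ℤ_[2]) = 𝒸 := funext fun x ↦ (h𝒸 x).symm
    rw [h1, h2, Submodule.coe_toAddSubgroup, image_eq_range_present (PowerSeries.map (padicIntToCoeffIntegers S)) 𝒸 z (RingEquiv.refl _) bvec crd hsum Φ hΦ,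
      Submodule.span_eq]
  -- (SAT): `ℤ₂`-saturation through `C (ι a) • x`
  have hZ : ∀ (a : ℤ_[2]) (x : I.H), x ∈ ((Submodule.span (IwasawaAlgebraO S) ({z} : Set I.H)).toAddSubgroup : AddSubgroup I.H) →
      ∃ x' ∈ ((Submodule.span (IwasawaAlgebraO S) ({z} : Set I.H)).toAddSubgroup : AddSubgroup I.H), locd x' = a • locd x := by
    intro a x hx
    refine ⟨(PowerSeries.C (padicIntToCoeffIntegers S a) : IwasawaAlgebraO S) • x, Submodule.smul_mem _ _ hx, ?_⟩
    rw [hlocd, hlocd, Prod.smul_mk, πₐ.hlocdS_smul, ← PowerSeries.map_C (padicIntToCoeffIntegers S) a, π.cvec_map_C_smul,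
      PowerSeries.C_eq_algebraMap, algebraMap_smul]
  -- (INJ): `π.cvec (a • z) = 0 → a = 0`, coordinates transported along `n = f`
  have hnf : n = π.f := CofreeTorsionCount.n_eq_of_theta S ρ W π.B (Θ π.v π.hv)
  have hinjZ : ∀ x ∈ ((Submodule.span (IwasawaAlgebraO S) ({z} : Set I.H)).toAddSubgroup : AddSubgroup I.H), (locd x).1 = 0 → x = 0 := by
    intro x hx h0
    obtain ⟨a, rfl⟩ := Submodule.mem_span_singleton.mp hx
    have h0' : 𝒸 (a • z) = 0 := by rw [h𝒸]; rw [hlocd] at h0; exact h0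
    -- coordinates on `Fin n`
    let bvec' : Fin n → IwasawaAlgebraO S := fun i ↦ bvec (finCongr hnf i)
    let crd' : IwasawaAlgebraO S →+ (Fin n → PowerSeries ℤ_[2]) :=
      { toFun := fun b i ↦ crd b (finCongr hnf i), map_zero' := by funext i; simp, map_add' := fun b b' ↦ by funext i; simp }
    have hsum' : ∀ b : IwasawaAlgebraO S, ∑ i, PowerSeries.map (padicIntToCoeffIntegers S) (crd' b i) * bvec' i = b := fun b ↦
      (Fintype.sum_equiv (finCongr hnf) (fun i ↦ PowerSeries.map (padicIntToCoeffIntegers S) (crd' b i) * bvec' i)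
        (fun j ↦ PowerSeries.map (padicIntToCoeffIntegers S) (crd b j) * bvec j) (fun _ ↦ rfl)).trans (hsum b)
    haveI : Module.Finite ℚ_[2] (ℚ_[2] ⊗[ℤ_[2]] ((Fin n → PowerSeries ℤ_[2]) ⧸
        Submodule.span (PowerSeries ℤ_[2]) (𝒸 '' (Submodule.span (IwasawaAlgebraO S) ({z} : Set I.H) : Set I.H)))) := by
      have h2 : (𝒸 : I.H → Fin n → PowerSeries ℤ_[2]) = π.cvec := funext h𝒸
      rw [h2]
      exact ‹Module.Finite ℚ_[2] (ℚ_[2] ⊗[ℤ_[2]] π.colocdQuot z)›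
    have ha : a = 0 := eq_zero_of_apply_smul_zeta_eq_zero_two_of_X_of_C (PowerSeries.map (padicIntToCoeffIntegers S)) 𝒸 z
      (fun y _ ↦ by rw [h𝒸, h𝒸]; exact π.cvec_map_X_smul hγ y) (fun b y _ ↦ by rw [h𝒸, h𝒸]; exact π.cvec_map_C_smul b y)
      bvec' crd' hsum' a h0'
    rw [ha, zero_smul]
  -- assemble
  have h := OnePair.finite_and_count_span_locd (A := ℤ_[2]) ℚ_[2] (Λ := PowerSeries ℤ_[2]) locd
    ((Submodule.span (IwasawaAlgebraO S) ({z} : Set I.H)).toAddSubgroup)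
    (Submodule.span (PowerSeries ℤ_[2]) (π.cvec '' (Submodule.span (IwasawaAlgebraO S) ({z} : Set I.H) : Set I.H))) hN hZ hinjZ
    (f := π.f) (d := d) (e := e) (σ := σ) (by rw [lamTwo_eq] at hQ; exact hQ) (by rw [lamTwo_eq] at hS; exact hS)
  exact h

end Summit.BirchSwinnertonDyer.BirchSwinnertonDyer.Theorems.OnePair.OnePairPins

end
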